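import Literature.NumberTheory.DiophantineGeometry.FaltingsHeight
import Literature.NumberTheory.DiophantineGeometry.WeierstrassFunctionFieldPlaces
import Literature.NumberTheory.DiophantineGeometry.FunctionFieldResidues
import Mathlib.FieldTheory.IsAlgClosed.AlgebraicClosure
import HarnessLib

/-!
# Belyi functions, the Belyi degree of a curve, and Javanpeykar's bound for the Faltings height

Topic `NumberTheory/DiophantineGeometry` (ledger item `wi-09957`: "fact: Javanpeykar 2014 Thm 1.1.1").

A *Belyi map* on a smooth projective connected curve `X` over `ℚ̄` is a finite morphism
`X → ℙ¹_ℚ̄` unramified over `ℙ¹ ∖ {0, 1, ∞}`; the *Belyi degree* `deg_B(X)` is the minimal degree of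
such a map (Belyi 1979; [cite: Javanpeykar2014, §1.1]; [cite: Zapponi2009BelyiDegree, §1.1]). The tree
so far only had the *pointed genus-`0`* notion (`Literature.NumberTheory.DiophantineGeometry.belyiDegree
(t : ℂ)`, file `BelyiDegree.lean`: Belyi maps `ℙ¹ → ℙ¹` with `0, 1, ∞, t` special). This file adds the
notion for curves of any genus, phrased — as everything about curves in this directory — through the
function field: a finite morphism `f : X → ℙ¹_K` of a complete non-singular curve `X/K` (`K`
algebraically closed) "is" a non-constant element `f` of the function field `F = K(X)`, its degree is
`[F : K(f)]`, the points of `X` are the places `P` of `F/K`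
(`Literature.NumberTheory.DiophantineGeometry.AlgFunctionField.PlaceOver`), the fibre over `c ∈ K` is
the set of places with `v_P(f - c) > 0`, and the ramification index of such a `P` over `c` is
`e_P = v_P(f - c)` (Stichtenoth, *Algebraic Function Fields and Codes*, §1.1, Thm. 1.4.11, §3.1; the
same dictionary is used in `FunctionFieldResidues` (`diffOrd`) and `FunctionFieldHurwitzTame`).

## Contents

* `AlgFunctionField.IsBelyiFunction K f` — `f ∈ F ∖ K` and, for every `c ∈ K ∖ {0, 1}` and every place
  `P` of `F/K`, `v_P(f - c) > 0 → v_P(f - c) = 1` (`f` is unramified over every point of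
  `ℙ¹ ∖ {0, 1, ∞}`; no condition over `0`, `1`, `∞`). Written for `K` algebraically closed — the only
  case in which it is used below and the setting of the sources (`ℚ̄`): then every place is rational
  (`PlaceOver.isRational_of_isAlgClosed`) and the closed points of `𝔸¹_K ∖ {0,1}` are exactly the
  `c ∈ K ∖ {0,1}`. (Over a non-closed `K` the predicate only expresses unramifiedness over the
  `K`-rational points of `ℙ¹ ∖ {0,1,∞}`, which is weaker than Zapponi's relative notion; it is not used
  in that generality.)
* `AlgFunctionField.belyiDegree K F := sInf {[F : K(f)] | f Belyi}` — the Belyi degree of `F/K`, i.e. of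
  the curve with function field `F` (junk value `0` when `F/K` has no Belyi function; by Belyi's theorem
  and its converse this happens exactly when the curve is not definable over `ℚ̄` — not proved here).
* API (all proved): `IsBelyiFunction.one_sub` (`f ↦ 1 - f`), `IsBelyiFunction.transcendental`,
  `IsBelyiFunction.finrank_pos` (`[F : K(f)] ≥ 1`), `belyiDegree_le_finrank`, `exists_finrank_eq_belyiDegree`,
  `belyiDegree_pos`.
* The NAMED FACT `javanpeykar2014_stableFaltingsHeight_le` (D-0014): **Javanpeykar 2014, Thm. 1.1.1,
  first row, for genus `g = 1`** — for an elliptic curve `E` over a number field `K` and every Belyi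
  function `f` on `E_{K̄}` (`K̄` an algebraic closure of `K`, i.e. a copy of `ℚ̄`),
  `h_F(E) ≤ 13 · 10⁶ · [K̄(E) : K̄(f)]⁵`; here `h_F` is the tree's
  `WeierstrassCurve.stableFaltingsHeight` (Faltings' normalisation, which is Javanpeykar's `h_Fal`:
  §2.3 "h_Fal(X) coincides with the stable Faltings height of the Jacobian of X_K", Lemma 2.4.4 for the
  normalisation `h = h_Fal + g log √π` of Bost–Gaudron–Rémond, matching the module docstring of
  `FaltingsHeight.lean`). PROVED corollary: `….le_belyiDegree_pow` (`h_F(E) ≤ 13·10⁶ deg_B(E_{K̄})⁵` as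
  printed, given one Belyi function).

## Faithfulness notes (for the reviewer)

* Printed statement [cite: Javanpeykar2014, Thm 1.1.1] (arXiv:1403.6404, p. 3, read): "For any smooth
  projective connected curve `X` over `ℚ̄` of genus `g ≥ 1`: `-log(2π) g ≤ h_Fal(X) ≤ 13·10⁶ g deg_B(X)⁵`,
  `0 ≤ e(X) ≤ 3·10⁷ (g-1) deg_B(X)⁵`, `0 ≤ Δ(X) ≤ 5·10⁸ g² deg_B(X)⁵`,
  `-10⁸ g² deg_B(X)⁵ ≤ δ_Fal(X) ≤ 2·10⁸ g deg_B(X)⁵`." Only the upper bound for `h_Fal` in genus `1` is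
  vendored: curves of genus `≥ 2` have no Faltings height in the tree (it is the stable height of the
  Jacobian; the interface `FaltingsHeightTheory` does not determine it), and `e`, `Δ`, `δ_Fal` are not
  defined. For `g = 1`, `X = E_{K̄}` for an elliptic curve `E/K` (`K` a number field), `Jac(X) = E` and
  `h_Fal(X) = h_F(E)`.
* "`h_F(E) ≤ 13·10⁶ deg_B(X)⁵`" is rendered as "`h_F(E) ≤ 13·10⁶ [K̄(E):K̄(f)]⁵` for EVERY Belyi function
  `f`", which follows from the printed form by `deg_B(X) ≤ deg f` and gives it back for an `f` of minimal
  degree (`….le_belyiDegree_pow`); this avoids the junk value of `sInf` and does not silently include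
  Belyi's existence theorem.
* The lower bound `-log(2π) ≤ h_F(E)` (Bost; Javanpeykar Lemma 2.4.4) is not vendored here (cf. the
  field `hF_ge` of `FaltingsHeightTheory` for Bost's bound in the Gaudron–Rémond normalisation).
* Not here: Belyi's theorem (existence of a Belyi function on every curve over `ℚ̄`), the genus-`0`
  comparison `AlgFunctionField.belyiDegree K K(x)` vs. the pointed `belyiDegree t` of `BelyiDegree.lean`,
  the bound `deg_B(E_λ) ≤ 2 deg_B(ℙ¹; 0,1,∞,λ)` for the Legendre curve (compose `x` with a pointed
  genus-`0` Belyi map), and the abc-corollary `log c ≪ deg_B(a/c)⁵` of the retired route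
  `ABC/BelyiDegreeSmooth` (it needs, besides this fact, Silverman 1986 Prop. 2.1 and that bound).

## References

* A. Javanpeykar, *Polynomial bounds for Arakelov invariants of Belyi curves*, with an appendix by
  P. Bruin, Algebra & Number Theory 8 (2014) 89–140, arXiv:1403.6404: §1.1 (definition of `deg_B`),
  Thm. 1.1.1, §2.3 (definition of `h_Fal`), Lemma 2.4.4. [Javanpeykar2014]
* L. Zapponi, *On the Belyi degree(s) of a curve defined over a number field*, arXiv:0904.0967, §1.1.
  [Zapponi2009BelyiDegree]
* H. Stichtenoth, *Algebraic Function Fields and Codes*, 2nd ed., GTM 254 (2009), §1.1 (places,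
  `v_P`), Thm. 1.4.11 (`deg (f)_0 = deg (f)_∞ = [F : K(f)]`), Def. 3.1.5 (ramification index).
  [Stichtenoth2009]
-/

noncomputable section

open scoped IntermediateField

universe u v

namespace Literature.NumberTheory.DiophantineGeometry.AlgFunctionField

variable (K : Type u) {F : Type v} [Field K] [Field F] [Algebra K F]

/-- **Belyi functions.** An element `f` of the function field `F/K` is a *Belyi function* if it is
non-constant (`f ∉ K`) and, as the finite morphism `f : X → ℙ¹_K` of the complete non-singular curve
`X` with `K(X) = F`, it is unramified over `ℙ¹ ∖ {0, 1, ∞}`: for every `c ∈ K` with `c ≠ 0, 1` and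
every place `P` of `F/K` in the fibre over `c` (i.e. with `v_P(f - c) > 0`) the ramification index
`e_P = v_P(f - c)` equals `1`. No condition is imposed over `0`, `1` and `∞` (the poles of `f`).
Written for `K` algebraically closed (the setting of the sources, `K = ℚ̄`), where every place is rational
and the closed points of `ℙ¹_K ∖ {0,1,∞}` are the `c ∈ K ∖ {0, 1}`; there this is exactly the notion
"finite morphism `X → ℙ¹_ℚ̄` unramified over `ℙ¹_ℚ̄ ∖ {0, 1, ∞}`" of [cite: Javanpeykar2014, §1.1] in the
language of function fields (Stichtenoth Def. 3.1.5: `e(P | P_c) = v_P(f - c)` for the place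
`P_c = (f - c)` of `K(f)` below `P`). Over a non-closed `K` it only tests the `K`-rational branch
points and is not used. -/
def IsBelyiFunction (f : F) : Prop :=
  f ∉ Set.range (algebraMap K F) ∧
    ∀ c : K, c ≠ 0 → c ≠ 1 → ∀ P : PlaceOver K F,
      0 < P.ord (f - algebraMap K F c) → P.ord (f - algebraMap K F c) = 1

variable (F) in
/-- **The Belyi degree `deg_B` of the function field `F/K`** (of the curve `X/K` with `K(X) = F`): the
least degree `[F : K(f)]` of a Belyi function `f ∈ F` ([cite: Javanpeykar2014, §1.1]: "the minimal degree
of a finite morphism `X → ℙ¹_ℚ̄` unramified over `ℙ¹_ℚ̄ ∖ {0,1,∞}`"; [cite: Zapponi2009BelyiDegree, §1.1]).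
Junk value `0` (`Nat.sInf ∅`) when `F/K` has no Belyi function — by Belyi's theorem this does not happen
for curves over `ℚ̄` (not proved here); a genuine Belyi degree is `≥ 1` (`belyiDegree_pos`). -/
def belyiDegree : ℕ :=
  sInf {n | ∃ f : F, IsBelyiFunction K f ∧ Module.finrank K⟮f⟯ F = n}

variable {K}

/-- Unfolding lemma for `IsBelyiFunction` [folklore]. -/
theorem isBelyiFunction_iff (f : F) :
    IsBelyiFunction K f ↔ f ∉ Set.range (algebraMap K F) ∧
      ∀ c : K, c ≠ 0 → c ≠ 1 → ∀ P : PlaceOver K F,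
        0 < P.ord (f - algebraMap K F c) → P.ord (f - algebraMap K F c) = 1 :=
  Iff.rfl

namespace IsBelyiFunction

variable {f : F}

/-- A Belyi function is not a constant [folklore]. -/
theorem not_mem_range (h : IsBelyiFunction K f) : f ∉ Set.range (algebraMap K F) :=
  h.1

/-- A Belyi function is unramified over every `c ≠ 0, 1`: `v_P(f - c) > 0 ⇒ v_P(f - c) = 1` [folklore]. -/
theorem ord_sub_eq_one (h : IsBelyiFunction K f) {c : K} (hc0 : c ≠ 0) (hc1 : c ≠ 1)
    (P : PlaceOver K F) (hP : 0 < P.ord (f - algebraMap K F c)) :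
    P.ord (f - algebraMap K F c) = 1 :=
  h.2 c hc0 hc1 P hP

/-- Over every `c ≠ 0, 1` a Belyi function has `v_P(f - c) ≤ 1` at all places [folklore]. -/
theorem ord_sub_le_one (h : IsBelyiFunction K f) {c : K} (hc0 : c ≠ 0) (hc1 : c ≠ 1)
    (P : PlaceOver K F) : P.ord (f - algebraMap K F c) ≤ 1 := by
  by_cases hP : 0 < P.ord (f - algebraMap K F c)
  · exact (h.ord_sub_eq_one hc0 hc1 P hP).le
  · exact (not_lt.1 hP).trans zero_le_one

/-- **`f ↦ 1 - f` preserves Belyi functions** (it permutes `0` and `1` and fixes `∞`): `(1 - f) - c =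
-(f - (1 - c))` and `v_P(-z) = v_P(z)`. [folklore] -/
theorem one_sub (h : IsBelyiFunction K f) : IsBelyiFunction K (1 - f) := by
  refine ⟨?_, fun c hc0 hc1 P hP => ?_⟩
  · rintro ⟨c, hc⟩
    exact h.1 ⟨1 - c, by rw [map_sub, map_one, hc, sub_sub_cancel]⟩
  · have hc0' : (1 - c : K) ≠ 0 := sub_ne_zero.2 (Ne.symm hc1)
    have hc1' : (1 - c : K) ≠ 1 := fun h1 => hc0 (by simpa using h1)
    have key : (1 - f) - algebraMap K F c = -(f - algebraMap K F (1 - c)) := by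
      rw [map_sub, map_one]; ring
    rw [key, PlaceOver.ord_neg] at hP ⊢
    exact h.ord_sub_eq_one hc0' hc1' P hP

/-- Over a full constant field, a Belyi function is transcendental over `K` [folklore]. -/
theorem transcendental [IsIntegrallyClosedIn K F] (h : IsBelyiFunction K f) : Transcendental K f :=
  transcendental_of_not_mem_range h.1

/-- The degree `[F : K(f)]` of a Belyi function of an algebraic function field `F/K` (with full constant
field `K`) is finite and positive (Stichtenoth Remark 1.1.2 / Thm. 1.4.11). [cite: Stichtenoth2009, Remark 1.1.2] -/
theorem finrank_pos [IsAlgFunctionField K F] [IsIntegrallyClosedIn K F] (h : IsBelyiFunction K f) :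
    0 < Module.finrank K⟮f⟯ F := by
  haveI := IsAlgFunctionField.finiteDimensional_adjoin_simple h.transcendental
  exact Module.finrank_pos

end IsBelyiFunction

/-- The Belyi degree is at most the degree of any Belyi function [folklore]. -/
theorem belyiDegree_le_finrank {f : F} (h : IsBelyiFunction K f) :
    belyiDegree K F ≤ Module.finrank K⟮f⟯ F :=
  Nat.sInf_le ⟨f, h, rfl⟩

/-- If `F/K` has a Belyi function, the Belyi degree is attained by one [folklore]. -/
theorem exists_finrank_eq_belyiDegree (hex : ∃ f : F, IsBelyiFunction K f) :
    ∃ f : F, IsBelyiFunction K f ∧ Module.finrank K⟮f⟯ F = belyiDegree K F := by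
  obtain ⟨f, hf⟩ := hex
  exact Nat.sInf_mem (s := {n | ∃ f : F, IsBelyiFunction K f ∧ Module.finrank K⟮f⟯ F = n})
    ⟨Module.finrank K⟮f⟯ F, f, hf, rfl⟩

/-- If `F/K` (an algebraic function field with full constant field `K`) has a Belyi function, its Belyi
degree is positive [folklore]. -/
theorem belyiDegree_pos [IsAlgFunctionField K F] [IsIntegrallyClosedIn K F]
    (hex : ∃ f : F, IsBelyiFunction K f) : 0 < belyiDegree K F := by
  obtain ⟨f, hf, hdeg⟩ := exists_finrank_eq_belyiDegree hex
  rw [← hdeg]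
  exact hf.finrank_pos

/-- With no Belyi function at all, the Belyi degree takes the junk value `0` [folklore]. -/
theorem belyiDegree_eq_zero_of_forall_not (h : ∀ f : F, ¬ IsBelyiFunction K f) :
    belyiDegree K F = 0 := by
  rw [belyiDegree, Nat.sInf_eq_zero]
  exact Or.inr (Set.eq_empty_iff_forall_notMem.mpr fun n ⟨f, hf, _⟩ => h f hf)

end Literature.NumberTheory.DiophantineGeometry.AlgFunctionField

/-! ### Javanpeykar 2014, Theorem 1.1.1 (genus one) -/

namespace Literature.NumberTheory.DiophantineGeometry

open AlgFunctionField

/-- **Javanpeykar 2014, Theorem 1.1.1 (first row, upper bound), genus `g = 1`.** Printed: "For any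
smooth projective connected curve `X` over `ℚ̄` of genus `g ≥ 1`, `-log(2π) g ≤ h_Fal(X) ≤ 13·10⁶ g
deg_B(X)⁵`" (with companion bounds for `e(X)`, `Δ(X)`, `δ_Fal(X)`), where `h_Fal(X)` is the stable
Faltings height of the Jacobian of `X` (§2.3) in Faltings' normalisation (Lemma 2.4.4) and `deg_B(X)` is
the minimal degree of a finite morphism `X → ℙ¹_ℚ̄` unramified over `ℙ¹ ∖ {0,1,∞}` (§1.1). Vendored
case: `X = E_{K̄}` for an elliptic curve `E` over a number field `K` given by a Weierstrass model `W`
(`K̄` any algebraic closure of `K`, a copy of `ℚ̄`), so `g = 1`, `Jac(X) = E` and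
`h_Fal(X) = W.stableFaltingsHeight`; and "`≤ 13·10⁶ deg_B(X)⁵`" is stated as "`≤ 13·10⁶ [K̄(E):K̄(f)]⁵`
for every Belyi function `f ∈ K̄(E)`" (equivalent: `deg_B ≤ deg f`, and `deg_B` is attained — see
`javanpeykar2014_stableFaltingsHeight_le.le_belyiDegree_pow`). The function field `K̄(E)` is Mathlib's
`WeierstrassCurve.Affine.FunctionField` of the base change `W.baseChange K̄`. Named fact (D-0014): the
proof is Arakelov theory on arithmetic surfaces (Merkl's bounds for Arakelov–Green functions on covers
of `X(2)`, a non-Weierstrass point of bounded height, Lenstra's bound for the different).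
[cite: Javanpeykar2014, Thm 1.1.1] -/
def javanpeykar2014_stableFaltingsHeight_le : Prop :=
  ∀ (K : Type) [Field K] [NumberField K] (W : WeierstrassCurve K) [W.IsElliptic]
    (Ω : Type) [Field Ω] [Algebra K Ω] [IsAlgClosure K Ω]
    (f : (W.baseChange Ω).toAffine.FunctionField),
    IsBelyiFunction Ω f →
      W.stableFaltingsHeight ≤
        13 * 10 ^ 6 * (Module.finrank Ω⟮f⟯ (W.baseChange Ω).toAffine.FunctionField : ℝ) ^ 5

/-- **`h_F(E) ≤ 13·10⁶ · deg_B(E_{K̄})⁵`** — the printed shape of Javanpeykar's Thm. 1.1.1 (genus `1`)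
with the Belyi degree `AlgFunctionField.belyiDegree K̄ K̄(E)`, for every elliptic curve `E/K` whose
`K̄(E)` carries a Belyi function (always, by Belyi's theorem — an assumption here). PROVED from the fact
(take a Belyi function of minimal degree, `exists_finrank_eq_belyiDegree`). [cite: Javanpeykar2014, Thm 1.1.1] -/
theorem javanpeykar2014_stableFaltingsHeight_le.le_belyiDegree_pow
    (h : javanpeykar2014_stableFaltingsHeight_le) (K : Type) [Field K] [NumberField K]
    (W : WeierstrassCurve K) [W.IsElliptic] (Ω : Type) [Field Ω] [Algebra K Ω] [IsAlgClosure K Ω]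
    (hex : ∃ f : (W.baseChange Ω).toAffine.FunctionField, IsBelyiFunction Ω f) :
    W.stableFaltingsHeight ≤
      13 * 10 ^ 6 * (belyiDegree Ω (W.baseChange Ω).toAffine.FunctionField : ℝ) ^ 5 := by
  obtain ⟨f, hf, hdeg⟩ := exists_finrank_eq_belyiDegree hex
  rw [← hdeg]
  exact h K W Ω f hf

end Literature.NumberTheory.DiophantineGeometry

end
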